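import Summits.CriticalPhenomena.CardyFormulaZ2.Theses.UnionJackBeffara
import Summits.CriticalPhenomena.CardyFormulaZ2.Theses.DWavePairKernel
import Literature.Probability.Percolation.UnionJackSeparating
import Literature.Probability.Percolation.SmirnovSeparatingData
import Summits.CriticalPhenomena.CardyFormulaZ2.Theorems.UnionJackBeffaraDefs

/-!
# Birth skeleton (BC3) for the crux `UnionJackMorera` — stmt-CriticalPhenomena-4558

Crux (route `UnionJackBeffara`, rank 2; shared verbatim with route `DWavePairKernel`, rank 5 — one
`Prop`, `Iff.rfl` certificate at the end of the file):

  `UnionJackMorera`: for every conformal rectangle `R = (Ω; a′, b′, c′, d′)` and every Carleson datum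
  `(a, b, c, d, ψ)` there are `δ₀ > 0` and two Smirnov separating families `g⁻, g⁺`
  (`IsSmirnovFamily R a b c δ₀ g`: continuous `[0,1]`-valued, Claim 22 equicontinuity, and for every
  subsequential uniform limit the contour relation (36) on lattice-parallel equilateral triangles and
  the boundary values (37)) with `g⁻_δ¹(z⁻_δ) − e(δ) ≤ P_{1/2,1/2}[C_δ(R) on δG_s] ≤ g⁺_δ¹(z⁺_δ) + e(δ)`,
  `z^∓_δ → d′`, `e → 0` — the `G_s` analogue of the PROVED triangular fact
  `smirnov_exists_separatingFamilies` (crude crossing probability `ujCrossingProb half R δ`, which is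
  the crux's inlined `let Z G P` by `ujCrossingProb_eq_letForm : … = … := rfl`).

## Why the stubs are pinned to `G_s` objects

Refuter evidence `UJEquiv.lean` on this item (2026-08-15): `IsSmirnovFamily` carries no lattice
content, so AS TYPED the crux is equivalent to Cardy's formula for crude site crossings of `G_s`
(`Target.1`); "split the discrete content into typed children". Both stubs below therefore speak
about the tree's genuine `G_s` observables (definition items of this route, landed in
`Literature/Probability/Percolation/UnionJack.lean`, `UnionJackSeparating.lean`): the separating
probabilities `ujSepProbFun T δ i` (`H^δ_i` of Smirnov/Beffara/Bollobás–Riordan (9), law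
`P_{1/2,1/2} = prodBernoulli (mixedParam half)`, crude discretisation of a continuum 3-marked domain
`T`) of inner/outer approximating domains `T^∓_δ`, and `ujCrossingProb half`.

## The line = the tree's seam (D) ⇐ (D′) of `SmirnovSeparatingData.lean`, transplanted to `G_s`

The tree proves the triangular (D) from discrete separating data (D′)
(`IsSeparatingData R ω S f`: `[0,1]`-values, density of the sample sets `S_δ`, `interior`,
approximate equicontinuity (Claim 22), the discrete Cauchy estimate `cauchy` (Lemma 13) and the
boundary behaviour (Claim 23), plus the sandwich (40)/(19)) by McShane interpolation
(`IsSeparatingData.isSmirnovFamily`, `smirnov_exists_separatingFamilies_of_separatingData`, PROVED).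
On `G_s` every field of (D′) except `cauchy` is RSW/duality technology (self-matching lattice,
`D₄` symmetry; RSW via KohlerSchindlerTassion2023), while `cauchy` is exactly where Beffara's defect
`ψ(e) = ((√3−3)/2)e^{iπ/3} ≠ 0` (`ujPsi_zero_one`, barrier `SmirnovTriangularOnly`) bites: there is no
termwise discrete Cauchy–Riemann identity on the 4.8.8 faces. So the crux is cut along that seam:

* `stub_ujSeparatingData` (A, "RSW half", size XL, believed routine-but-long): for every conformal
  rectangle there are inner/outer approximating 3-marked domains `T^∓ : ℝ → MarkedDomain 3`
  (`UJApprox`: arcs `o(1)`-close to those of `(Ω; a′, b′, c′)`, compacta of `Ω` eventually inside)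
  and finite sample sets `S^∓_δ` such that the `G_s` separating probabilities
  `f^∓_δ = ujSepProbFun (T^∓ δ) δ` have the (D′) properties `dense`, `interior`, `equicontinuous`,
  `boundary` (`IsUJDataRSW`, the fields of `IsSeparatingData` verbatim) and sandwich
  `ujCrossingProb half R δ` at points `z^∓_δ → d′` up to `e(δ) → 0` — Bollobás–Riordan Lemma 14 with
  (19), Claims 17–22, (35), (40) and pp. 200–201 transplanted to `G_s` (tree templates:
  `tri_exists_discreteApprox_proof`, `tri_sepProb_sub_le_of_dualPath`, `tri_sepProb_boundary_tendsto`,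
  `tri_openCrossingProb_approx_sepProb`).
* `stub_ujDiscreteMorera` (B, "Morera half", the open problem; HARDEST): for every Carleson datum and
  EVERY approximating family `T` (`UJApprox R T`), the `G_s` separating probabilities satisfy the
  discrete Morera estimate that replaces Lemma 13: the Riemann sums
  `∮ᴰ_C (f_δ^{i+1} − ω f_δ^i) dz`, `ω = triangleTurn a b c`, along the equilateral lattice contours
  `C` demanded by `IsSmirnovFamily.limit_contour` ((36) is asked on `ζ`-parallel equilateral
  triangles; (M) `triangleIntegral_eq_zero_of_forall_lattice_holds` then gives all triangles) are
  `≤ n δ e(δ)` = `o(length)` uniformly over contours in a compactum of `Ω` — the `cauchy` field of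
  `IsSeparatingData` for `f = ujSepProbFun ∘ T`. Given A's equicontinuity this is equivalent to
  "(36) for every subsequential local-uniform limit of `H^δ`", i.e. to the holomorphicity that
  Beffara's (discr) `∮ H_δ dz = Σ_e ψ(e) P_A(e) + o(1)` leaves open on `T_s`; the route's intended
  proof is its foreseen split LevelOneExpansion (SE) → NonVacuity (`β ≠ 2i`) → DiscrIdentityUJ
  (relabelling and quarter-turn covariances of (discr) constrain the marginal `O(1)` term to
  `β ∫∫ ∂̄h`). Why it might fail: `β(G_s) = 2i` (a non-conformal subsequential limit hides exactly
  there, Beffara2008Universal §4.2).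

`UnionJackMorera_of` (kernel-checked, no `sorry`): A's data plus B's estimate (for `T⁻` and `T⁺`)
assemble two `IsSeparatingData R (triangleTurn a b c) S^∓ f^∓` (`[0,1]`-values by
`ujSepProbFun_mem_Icc`); the tree's `IsSeparatingData.isSmirnovFamily` (McShane interpolants
`dataFamily`) and the sandwich bookkeeping of `smirnov_exists_separatingFamilies_of_separatingData`
(copied with the crossing probability abstracted to `p`) give the crux BY NAME
(`ujCrossingProb half R δ` is definitionally the crux's `P half R δ`).

Orientation: `ω = triangleTurn a b c = e^{±2πi/3}` according as `abc` is anticlockwise/clockwise; a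
Carleson map forces the marking `(a′, b′, c′)` of `R` to have the orientation of `abc`, and
`UJApprox` (each arc of `T δ` close to the SAME-label arc of `forgetLast R`) forces the labels of
`T δ` to follow; so B is stated for both orientations at once (no reflection step, unlike the
tree's `tri_*` facts which fix `triOmega`).

Disproof used / dead lines: none exist for this crux (`ledger crux ls stmt-CriticalPhenomena-4558`:
no workfiles, 2026-08-17); negatives index: no refuted statement of CardyFormulaZ2 is assumed (the
stubs are existence/estimate statements about `ujSepProbFun`, not about abstract families).

References: Beffara2008Universal (arXiv:0708.3908) §3 eq. (discr), §4.1–4.2; BollobasRiordan2006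
Ch. 7 §7.2.4–7.2.6 (Lemma 13 p. 181, Lemma 14 p. 184, Claims 22–23 pp. 197–201, (40)); Smirnov2001
Thm 1; KohlerSchindlerTassion2023 (RSW); GarbanPeteSchramm2013, Kesten1986 (ratio limits for (SE)).

## Lead's log (prover-line-stmt-CriticalPhenomena-4558-0)

* 2026-08-17 cycle 1: line picked (`PICKED.md`); skeleton registered; hypothesis bundles re-housed
  in `Theorems/UnionJackBeffaraDefs.lean` (p147387, landed) and imported here. Wave 1 (worker W1 on
  Stub A): statement audited TRUE as stated (index `1` / `R.pt 3` / `forgetLast` arcs confirmed;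
  evidence `stub_ujSeparatingData.md` on the item), blocked on an absent `G_s` toolkit (T1 RSW
  box crossings for `P_{1/2,1/2}` sites on `unionJackGraph` [Kesten1982 Thm 6.1,
  KohlerSchindlerTassion2023], T2 duality, T3 one-arm bound, T4 crude-domain topology / Claim 10,
  T5 a boundary-collar three-arm estimate, T6 (40)+sandwich); RSW-free glue proved: `ujFaceAt`
  geometry, deep sample faces are domain faces off every crude arc, and the COLLAR FAMILIES
  `collarFamily R 𝒯 σ w` (the tree's `collarRect`, Bollobás–Riordan's longer–thinner /
  shorter–fatter domains) are `UJApprox` (`ujApprox_collarFamily`) — the intended `T^∓`.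
  New junk regime recorded (W1): the targets of `UJSeparates` are ALL faces with a vertex in the
  `2δ`-thick band of `A_i`, so `E_i(z)` is the thin-arc event of the domain with the `≈ 2.7δ`
  collar of `A_i` removed — a different effective domain per index; cross-index identities
  (duality `H_{i+1}+H_{i+2} → 1`, Claim 10, the colour-switching pairing behind Stub B) hold up
  to collar events whose probability → 0 needs T5, not Lemma 4 alone. Stub B: audited (implied by,
  and morally equivalent to, local-uniform convergence of `H^δ` to Smirnov's triple for every
  `UJApprox` family = universality; degenerate crude arcs make it trivially true, never false);
  Monte Carlo of its statistic `|S_i(C)|/(nδ)` on `G_s` vs `𝕋` submitted (job j023948).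
-/

noncomputable section

open Set Filter Topology Metric MeasureTheory
open Literature.Probability.LatticeModels Literature.Probability.Percolation
open Literature.Probability.RandomPlanarGeometry Literature.Probability.RandomPlanarGeometry.MarkedDomain

namespace Summit.CriticalPhenomena.CardyFormulaZ2.Cruxes.UnionJackMorera.Birth

open Summit.CriticalPhenomena.CardyFormulaZ2.Theses.UnionJackBeffara (UnionJackMorera)

/-! ### The two bundles of hypotheses `UJApprox R T`, `IsUJDataRSW R T S`

They are imported from the landed definitions module
`Summits/CriticalPhenomena/CardyFormulaZ2/Theorems/UnionJackBeffaraDefs.lean` (p147387, same namespace;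
verbatim the text registered with the stubs): `UJApprox R T` — `T : ℝ → MarkedDomain 3` approximates
`forgetLast R` (same-label arcs mutually `ε(δ)`-close, `ε → 0`; compacta of `Ω` eventually inside
`(T δ).carrier`); `IsUJDataRSW R T S` — the fields `dense`, `interior`, `equicontinuous`, `boundary` of
`IsSeparatingData` verbatim for `f δ i = ujSepProbFun (T δ) δ i` on the sample sets `S δ`. Glue landed
with them: `ujApprox_const` (the constant family approximates). -/

/-! ### The two registered stubs (the ONLY `sorry`s of this file) -/

/-- **Stub A — `G_s` separating data, the RSW half of (D′) (Bollobás–Riordan Lemma 14 with (19),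
Claims 17–22, (35), (40), pp. 200–201, transplanted to critical site percolation on the centred
square lattice).** For every conformal rectangle `R` there are inner and outer approximating
families `T⁻, T⁺` of 3-marked domains (`UJApprox`) and finite sample sets `S^∓_δ` such that the
`G_s` separating probabilities `ujSepProbFun (T^∓ δ) δ` are dense/interior/approximately
equicontinuous/have the (37) boundary behaviour (`IsUJDataRSW`), and sandwich the crude
`P_{1/2,1/2}` crossing probability `ujCrossingProb half R δ` at sample points `z^∓_δ ∈ Ω`,
`z^∓_δ → d′ = R.pt 3`, up to `e(δ) → 0`. Inputs: RSW on `G_s` (self-matching + `D₄`;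
KohlerSchindlerTassion2023), one-arm decay (Lemma 4 analogue), self-matching duality (Lemma 5
analogue), Smirnov's three-arm description of `E(z′) ∖ E(z)` (Claim 10), and the construction of
locally connected approximating domains (Claims 17–21). Size XL; why it might fail: only through a
mis-transplanted convention of the crude discretisation (`ujSepEvent`'s junk regimes near `∂(T δ)`),
repairable by the choice of `T^∓`, `S^∓`. -/
theorem stub_ujSeparatingData :
    ∀ R : ConformalRectangle,
      ∃ (Tm Tp : ℝ → MarkedDomain 3) (Sm Sp : ℝ → Finset ℂ),
        UJApprox R Tm ∧ UJApprox R Tp ∧ IsUJDataRSW R Tm Sm ∧ IsUJDataRSW R Tp Sp ∧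
          ∃ (zm zp : ℝ → ℂ) (e : ℝ → ℝ),
            (∀ᶠ δ in 𝓝[>] (0 : ℝ),
                zm δ ∈ Sm δ ∧ zm δ ∈ R.carrier ∧ zp δ ∈ Sp δ ∧ zp δ ∈ R.carrier) ∧
              Tendsto zm (𝓝[>] 0) (𝓝 (R.pt 3)) ∧ Tendsto zp (𝓝[>] 0) (𝓝 (R.pt 3)) ∧
                Tendsto e (𝓝[>] 0) (𝓝 0) ∧
                  ∀ᶠ δ in 𝓝[>] (0 : ℝ),
                    ujSepProbFun (Tm δ) δ 1 (zm δ) - e δ ≤ ujCrossingProb half R δ ∧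
                      ujCrossingProb half R δ ≤ ujSepProbFun (Tp δ) δ 1 (zp δ) + e δ := by
  sorry

/-- **Stub B — discrete Morera on `G_s` (the replacement of Bollobás–Riordan's Lemma 13; the
open problem, where `ψ ≠ 0` bites).** For every conformal rectangle with a Carleson datum
`(a, b, c, d, ψ)` and EVERY approximating family `T` (`UJApprox R T`), the `G_s` separating
probabilities `f_δ = ujSepProbFun (T δ) δ` satisfy, uniformly over the equilateral lattice contours
`C : p → p + n s → p + n s ζ → p` (`s = ±δ`) inside a compactum `K ⊆ Ω` and eventually in `δ`,
`‖∮ᴰ_C f_δ^{i+1} dz − ω ∮ᴰ_C f_δ^i dz‖ ≤ n δ e(δ)` with `e(δ) → 0` and `ω = triangleTurn a b c`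
(`∮ᴰ = discreteTriangleIntegral`, the face-centre Riemann sum of `SmirnovSeparatingData.lean`) —
the `cauchy` field of `IsSeparatingData` for `f = ujSepProbFun ∘ T`. On `𝕋` this is Lemma 13
(summation by parts + exact colour switching + exact `2π/3` rotation of the three dual edges); on
`T_s` the rotation defect `ψ(e) ≠ 0` leaves Beffara's `Σ_e ψ(e) P_A(e)`, of order `δ^{-1/3}` before
cancellation, and the stub asserts the cancellation down to `o(length)` — equivalently (given
Stub A's equicontinuity) the contour relation (36) for every subsequential local-uniform limit of
`H^δ`. Intended proof (route TWO-LAYER PLAN): level-one two-scale expansion (SE) of the six oriented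
3-arm pattern probabilities `ujEdgePatternProb` (Kesten1986 / GarbanPeteSchramm2013 ratio limits),
the relabelling and quarter-turn covariances of (discr), and `β(G_s) ≠ 2i`. Why it might fail:
`β = 2i`, i.e. a non-conformal subsequential limit (Beffara2008Universal §4.2). Size: open-problem. -/
theorem stub_ujDiscreteMorera :
    ∀ (R : ConformalRectangle) (a b c d : ℂ) (ψ : ConformalEquiv R.carrier (openTriangle a b c)),
      IsEquilateral a b c → d ∈ openSegment ℝ c a → IsCarlesonMap R a b c d ψ →
        ∀ T : ℝ → MarkedDomain 3, UJApprox R T →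
          ∃ e : ℝ → ℝ, Tendsto e (𝓝[>] 0) (𝓝 0) ∧ ∀ K : Set ℂ, IsCompact K → K ⊆ R.carrier →
            ∀ᶠ δ in 𝓝[>] (0 : ℝ), ∀ (i : Fin 3) (x : Site 2) (n : ℕ) (s : ℝ), (s = δ ∨ s = -δ) →
              convexHull ℝ {triMeshPoint δ x, triMeshPoint δ x + n * s,
                  triMeshPoint δ x + n * s * triZeta} ⊆ K →
                ‖discreteTriangleIntegral (ujSepProbFun (T δ) δ (i + 1)) (triMeshPoint δ x) s n -
                    triangleTurn a b c *
                      discreteTriangleIntegral (ujSepProbFun (T δ) δ i) (triMeshPoint δ x) s n‖ ≤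
                  n * δ * e δ := by
  sorry

/-! ### Composition (sorry-free) -/

/-- **(D) from (D′) with the crossing probability abstracted** — the bookkeeping of the tree's
`smirnov_exists_separatingFamilies_of_separatingData` (Bollobás–Riordan 2006, §7.2.6 pp. 196–203)
for an arbitrary sandwiched quantity `p : ℝ → ℝ`: two systems of separating data in the sense of
`IsSeparatingData` whose first coordinates sandwich `p` at points `z^∓_δ → d′` yield two Smirnov
separating families (the McShane interpolants `dataFamily`) sandwiching `p`. Real proof, copied
from the tree with `triDomainCrossingProb R` replaced by `p`. -/
theorem separatingFamilies_of_separatingData (p : ℝ → ℝ) {R : ConformalRectangle} {a b c : ℂ}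
    {Sm Sp : ℝ → Finset ℂ} {fm fp : ℝ → Fin 3 → ℂ → ℝ}
    (hDm : IsSeparatingData R (triangleTurn a b c) Sm fm)
    (hDp : IsSeparatingData R (triangleTurn a b c) Sp fp) {zm zp : ℝ → ℂ} {e : ℝ → ℝ}
    (hmem : ∀ᶠ δ in 𝓝[>] (0 : ℝ), zm δ ∈ Sm δ ∧ zm δ ∈ R.carrier ∧ zp δ ∈ Sp δ ∧ zp δ ∈ R.carrier)
    (hzm : Tendsto zm (𝓝[>] 0) (𝓝 (R.pt 3))) (hzp : Tendsto zp (𝓝[>] 0) (𝓝 (R.pt 3)))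
    (he : Tendsto e (𝓝[>] 0) (𝓝 0))
    (hsand : ∀ᶠ δ in 𝓝[>] (0 : ℝ), fm δ 1 (zm δ) - e δ ≤ p δ ∧ p δ ≤ fp δ 1 (zp δ) + e δ) :
    ∃ δ₀ > (0 : ℝ), ∃ gm gp : ℝ → Fin 3 → ℂ → ℝ,
      IsSmirnovFamily R a b c δ₀ gm ∧ IsSmirnovFamily R a b c δ₀ gp ∧
        ∃ (zm zp : ℝ → ℂ) (e : ℝ → ℝ), (∀ δ ∈ Ioo 0 δ₀, zm δ ∈ R.carrier ∧ zp δ ∈ R.carrier) ∧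
          Tendsto zm (𝓝[>] 0) (𝓝 (R.pt 3)) ∧ Tendsto zp (𝓝[>] 0) (𝓝 (R.pt 3)) ∧
            Tendsto e (𝓝[>] 0) (𝓝 0) ∧
              ∀ δ ∈ Ioo 0 δ₀, gm δ 1 (zm δ) - e δ ≤ p δ ∧ p δ ≤ gp δ 1 (zp δ) + e δ := by
  obtain ⟨εm, hεm, hdensem⟩ := hDm.dense
  obtain ⟨εp, hεp, hdensep⟩ := hDp.dense
  set gm : ℝ → Fin 3 → ℂ → ℝ := dataFamily Sm fm εm with hgm
  set gp : ℝ → Fin 3 → ℂ → ℝ := dataFamily Sp fp εp with hgp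
  -- the horizon `δ₀`
  obtain ⟨δ₀, hδ₀, hgood⟩ := exists_forall_Ioo_of_eventually (hmem.and hsand)
  -- the error `e' = e + (g⁻(z⁻) - f⁻(z⁻))`
  set e' : ℝ → ℝ := fun δ => e δ + (gm δ 1 (zm δ) - fm δ 1 (zm δ)) with he'_def
  have hdiff : Tendsto (fun δ => gm δ 1 (zm δ) - fm δ 1 (zm δ)) (𝓝[>] 0) (𝓝 0) := by
    rw [Metric.tendsto_nhdsWithin_nhds]
    intro η hη
    obtain ⟨δ₁, hδ₁, h₁⟩ := exists_forall_Ioo_of_eventually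
      ((dataFamily_approx hDm hεm (half_pos hη)).and hmem)
    refine ⟨δ₁, hδ₁, fun {δ} hδpos hδd => ?_⟩
    have hδ : δ ∈ Ioo 0 δ₁ := by
      refine ⟨hδpos, ?_⟩
      rw [Real.dist_eq, sub_zero, abs_of_pos (mem_Ioi.1 hδpos)] at hδd
      exact hδd
    obtain ⟨happ, hm⟩ := h₁ δ hδ
    have h := happ 1 (zm δ) hm.1
    rw [Real.dist_0_eq_abs, abs_lt]
    constructor <;> simp only [hgm] <;> linarith [h.1, h.2]
  have he' : Tendsto e' (𝓝[>] 0) (𝓝 0) := by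
    simpa using he.add hdiff
  refine ⟨δ₀, hδ₀, gm, gp, hDm.isSmirnovFamily hεm hdensem δ₀, hDp.isSmirnovFamily hεp hdensep δ₀,
    zm, zp, e', fun δ hδ => ⟨(hgood δ hδ).1.2.1, (hgood δ hδ).1.2.2.2⟩, hzm, hzp, he', fun δ hδ => ?_⟩
  obtain ⟨⟨hzm₁, -, hzp₁, -⟩, hlow, hup⟩ := hgood δ hδ
  constructor
  · -- `g⁻(z⁻) - e' = f⁻(z⁻) - e ≤ p`
    simp only [he'_def]
    linarith
  · -- `p ≤ f⁺(z⁺) + e ≤ g⁺(z⁺) + e ≤ g⁺(z⁺) + e'`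
    have h1 : fp δ 1 (zp δ) ≤ gp δ 1 (zp δ) := mcShane.le_self hzp₁
    have h2 : fm δ 1 (zm δ) ≤ gm δ 1 (zm δ) := mcShane.le_self hzm₁
    simp only [he'_def]
    linarith

/-- **The two halves assemble to full separating data.** Stub A's RSW data for an approximating
family `T` with sample sets `S`, plus Stub B's discrete Morera estimate for the same `T`, are
`IsSeparatingData R (triangleTurn a b c) S (ujSepProbFun ∘ T)` (`[0,1]`-values by
`ujSepProbFun_mem_Icc`). -/
theorem isSeparatingData_of_halves {R : ConformalRectangle} {a b c : ℂ} {T : ℝ → MarkedDomain 3}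
    {S : ℝ → Finset ℂ} (hA : IsUJDataRSW R T S)
    (hB : ∃ e : ℝ → ℝ, Tendsto e (𝓝[>] 0) (𝓝 0) ∧ ∀ K : Set ℂ, IsCompact K → K ⊆ R.carrier →
      ∀ᶠ δ in 𝓝[>] (0 : ℝ), ∀ (i : Fin 3) (x : Site 2) (n : ℕ) (s : ℝ), (s = δ ∨ s = -δ) →
        convexHull ℝ {triMeshPoint δ x, triMeshPoint δ x + n * s,
            triMeshPoint δ x + n * s * triZeta} ⊆ K →
          ‖discreteTriangleIntegral (ujSepProbFun (T δ) δ (i + 1)) (triMeshPoint δ x) s n -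
              triangleTurn a b c *
                discreteTriangleIntegral (ujSepProbFun (T δ) δ i) (triMeshPoint δ x) s n‖ ≤
            n * δ * e δ) :
    IsSeparatingData R (triangleTurn a b c) S (fun δ => ujSepProbFun (T δ) δ) where
  mem_Icc δ i w _ := ujSepProbFun_mem_Icc (T δ) δ i w
  dense := hA.dense
  interior := hA.interior
  equicontinuous := hA.equicontinuous
  cauchy := hB
  boundary := hA.boundary

/-- **The crux with the crossing probability abstracted**: Stub A (stated for an arbitrary family
`p R` of sandwiched quantities) and Stub B give, for every conformal rectangle and Carleson datum,
two Smirnov separating families sandwiching `p R`. -/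
theorem smirnovFamilies_of_ujData (p : ConformalRectangle → ℝ → ℝ)
    (hA : ∀ R : ConformalRectangle,
      ∃ (Tm Tp : ℝ → MarkedDomain 3) (Sm Sp : ℝ → Finset ℂ),
        UJApprox R Tm ∧ UJApprox R Tp ∧ IsUJDataRSW R Tm Sm ∧ IsUJDataRSW R Tp Sp ∧
          ∃ (zm zp : ℝ → ℂ) (e : ℝ → ℝ),
            (∀ᶠ δ in 𝓝[>] (0 : ℝ),
                zm δ ∈ Sm δ ∧ zm δ ∈ R.carrier ∧ zp δ ∈ Sp δ ∧ zp δ ∈ R.carrier) ∧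
              Tendsto zm (𝓝[>] 0) (𝓝 (R.pt 3)) ∧ Tendsto zp (𝓝[>] 0) (𝓝 (R.pt 3)) ∧
                Tendsto e (𝓝[>] 0) (𝓝 0) ∧
                  ∀ᶠ δ in 𝓝[>] (0 : ℝ),
                    ujSepProbFun (Tm δ) δ 1 (zm δ) - e δ ≤ p R δ ∧
                      p R δ ≤ ujSepProbFun (Tp δ) δ 1 (zp δ) + e δ)
    (hB : ∀ (R : ConformalRectangle) (a b c d : ℂ)
      (ψ : ConformalEquiv R.carrier (openTriangle a b c)),
      IsEquilateral a b c → d ∈ openSegment ℝ c a → IsCarlesonMap R a b c d ψ →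
        ∀ T : ℝ → MarkedDomain 3, UJApprox R T →
          ∃ e : ℝ → ℝ, Tendsto e (𝓝[>] 0) (𝓝 0) ∧ ∀ K : Set ℂ, IsCompact K → K ⊆ R.carrier →
            ∀ᶠ δ in 𝓝[>] (0 : ℝ), ∀ (i : Fin 3) (x : Site 2) (n : ℕ) (s : ℝ), (s = δ ∨ s = -δ) →
              convexHull ℝ {triMeshPoint δ x, triMeshPoint δ x + n * s,
                  triMeshPoint δ x + n * s * triZeta} ⊆ K →
                ‖discreteTriangleIntegral (ujSepProbFun (T δ) δ (i + 1)) (triMeshPoint δ x) s n -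
                    triangleTurn a b c *
                      discreteTriangleIntegral (ujSepProbFun (T δ) δ i) (triMeshPoint δ x) s n‖ ≤
                  n * δ * e δ) :
    ∀ (R : ConformalRectangle) (a b c d : ℂ) (ψ : ConformalEquiv R.carrier (openTriangle a b c)),
      IsEquilateral a b c → d ∈ openSegment ℝ c a → IsCarlesonMap R a b c d ψ →
        ∃ δ₀ > (0 : ℝ), ∃ gm gp : ℝ → Fin 3 → ℂ → ℝ,
          IsSmirnovFamily R a b c δ₀ gm ∧ IsSmirnovFamily R a b c δ₀ gp ∧
            ∃ (zm zp : ℝ → ℂ) (e : ℝ → ℝ),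
              (∀ δ ∈ Ioo 0 δ₀, zm δ ∈ R.carrier ∧ zp δ ∈ R.carrier) ∧
                Tendsto zm (𝓝[>] 0) (𝓝 (R.pt 3)) ∧ Tendsto zp (𝓝[>] 0) (𝓝 (R.pt 3)) ∧
                  Tendsto e (𝓝[>] 0) (𝓝 0) ∧
                    ∀ δ ∈ Ioo 0 δ₀, gm δ 1 (zm δ) - e δ ≤ p R δ ∧ p R δ ≤ gp δ 1 (zp δ) + e δ := by
  intro R a b c d ψ habc hd hψ
  obtain ⟨Tm, Tp, Sm, Sp, hTm, hTp, hDm, hDp, zm, zp, e, hmem, hzm, hzp, he, hsand⟩ := hA R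
  have hDm' := isSeparatingData_of_halves hDm (hB R a b c d ψ habc hd hψ Tm hTm)
  have hDp' := isSeparatingData_of_halves hDp (hB R a b c d ψ habc hd hψ Tp hTp)
  exact separatingFamilies_of_separatingData (p R) hDm' hDp' hmem hzm hzp he hsand

/-- **The skeleton as a (conditional) proof of the crux** — the A12 shape audited by
`ledger skeleton check`: no hypotheses, concludes `UnionJackMorera` BY NAME, and depends on
`sorryAx` ONLY through `stub_ujSeparatingData` and `stub_ujDiscreteMorera` (it is placed before
`UnionJackMorera_of`, of which it is the instance at the two stubs, because the checker takes the
first theorem of the file concluding the crux as the skeleton). -/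
theorem unionJackMorera_of_stubs : UnionJackMorera :=
  smirnovFamilies_of_ujData (fun R δ => ujCrossingProb half R δ) stub_ujSeparatingData
    stub_ujDiscreteMorera

/-- **Assembly of the line (BC3 shape; kernel-checked, no `sorry`): the two stub statements imply
the crux `UnionJackMorera` BY NAME.** `ujCrossingProb half R δ` is definitionally the crux's
inlined `P half R δ` (`ujCrossingProb_eq_letForm`, `rfl`). -/
theorem UnionJackMorera_of :
    (∀ R : ConformalRectangle,
      ∃ (Tm Tp : ℝ → MarkedDomain 3) (Sm Sp : ℝ → Finset ℂ),
        UJApprox R Tm ∧ UJApprox R Tp ∧ IsUJDataRSW R Tm Sm ∧ IsUJDataRSW R Tp Sp ∧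
          ∃ (zm zp : ℝ → ℂ) (e : ℝ → ℝ),
            (∀ᶠ δ in 𝓝[>] (0 : ℝ),
                zm δ ∈ Sm δ ∧ zm δ ∈ R.carrier ∧ zp δ ∈ Sp δ ∧ zp δ ∈ R.carrier) ∧
              Tendsto zm (𝓝[>] 0) (𝓝 (R.pt 3)) ∧ Tendsto zp (𝓝[>] 0) (𝓝 (R.pt 3)) ∧
                Tendsto e (𝓝[>] 0) (𝓝 0) ∧
                  ∀ᶠ δ in 𝓝[>] (0 : ℝ),
                    ujSepProbFun (Tm δ) δ 1 (zm δ) - e δ ≤ ujCrossingProb half R δ ∧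
                      ujCrossingProb half R δ ≤ ujSepProbFun (Tp δ) δ 1 (zp δ) + e δ) →
    (∀ (R : ConformalRectangle) (a b c d : ℂ) (ψ : ConformalEquiv R.carrier (openTriangle a b c)),
      IsEquilateral a b c → d ∈ openSegment ℝ c a → IsCarlesonMap R a b c d ψ →
        ∀ T : ℝ → MarkedDomain 3, UJApprox R T →
          ∃ e : ℝ → ℝ, Tendsto e (𝓝[>] 0) (𝓝 0) ∧ ∀ K : Set ℂ, IsCompact K → K ⊆ R.carrier →
            ∀ᶠ δ in 𝓝[>] (0 : ℝ), ∀ (i : Fin 3) (x : Site 2) (n : ℕ) (s : ℝ), (s = δ ∨ s = -δ) →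
              convexHull ℝ {triMeshPoint δ x, triMeshPoint δ x + n * s,
                  triMeshPoint δ x + n * s * triZeta} ⊆ K →
                ‖discreteTriangleIntegral (ujSepProbFun (T δ) δ (i + 1)) (triMeshPoint δ x) s n -
                    triangleTurn a b c *
                      discreteTriangleIntegral (ujSepProbFun (T δ) δ i) (triMeshPoint δ x) s n‖ ≤
                  n * δ * e δ) →
    UnionJackMorera := by
  intro hA hB
  exact smirnovFamilies_of_ujData (fun R δ => ujCrossingProb half R δ) hA hB

/-- The same composition concludes the shared decl as filed on route `DWavePairKernel` (rank 5):
the two `def`s are syntactically identical. -/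
theorem unionJackMorera_of_stubs_dWave :
    Summit.CriticalPhenomena.CardyFormulaZ2.Theses.DWavePairKernel.UnionJackMorera :=
  UnionJackMorera_of stub_ujSeparatingData stub_ujDiscreteMorera

-- Certificate that the shared decl is ONE `Prop` across the two route files (definitional):
example : UnionJackMorera ↔
    Summit.CriticalPhenomena.CardyFormulaZ2.Theses.DWavePairKernel.UnionJackMorera :=
  Iff.rfl

-- Non-vacuity of the hypothesis bundle of Stub B: the constant family approximates.
example (R : ConformalRectangle) : UJApprox R (fun _ => forgetLast R) :=
  ujApprox_const R

end Summit.CriticalPhenomena.CardyFormulaZ2.Cruxes.UnionJackMorera.Birth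

end
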